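import Summits.QuantumFields.BalabanUV.T4Continuum.Spine.NE3.PairLandauB8EndSfClassB8
import Summits.QuantumFields.BalabanUV.T4Continuum.Spine.NE3.LandauCorrectionSupB8Curved
import Summits.QuantumFields.BalabanUV.T4Continuum.Spine.NE3.LeafIndexSockets
import Summits.QuantumFields.BalabanUV.T4Continuum.Spine.NE3.PairLandauB8EndSupFacts
import HarnessLib

/-!
# T⁴ programme, node NE3 — THE END ON B8's SURFACE OVER `sfClass` WITH THE SUP LETTER `hF5` DISCHARGED BY THE SUP-FORM THM-1-TYPE LEAF (H3ˢᵘᵖ):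
# covariant root ⇐ `PairLandauGaugeB8Avg` ∧ Π-REG per pair (F6) ∧ (H3ˢᵘᵖ) ([B11] Thm 1 (8)+(10) TYPE, the leaf route (A) already carries) ∧ (P♮) on `slicB8` per pair
# ∧ UNIFORM numeric lines — the [B9] (3.42)∕(3.49)-TYPE binder `hF5` ((H0_W) + (HR_W)) is GONE

Cell `pub-balaban-gaps` (YM blitz, track G2, seat `ne3`, unit `pub-balaban-gaps-ne3-g9`; writer prover-pub-balaban-gaps-ne3-g9-0, 2026-08-24), census
`run/shared/lean/pub/pub-balaban-gaps/ne/NE3.md` §4 R34∕R39∕R40, §15.  WHY.  THE END of record `PairLandauB8EndSfClassB8.ne3EnergyRateWCov_sfClass_B8` takes, per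
pair, the F5 shape `hF5 : … → LandauCorrectionSupB8 hL j hWu hx hs hWx N hθ K₀ K₁` at `W = cavg L U_B` with UNIFORM `K₀ K₁` — B9's sup-norm facts (3.42) ((H0_W)) and
(3.25)∕(3.49) ((HR_W)) about `Δ_W` on `N(Q′(W))`, TYPES.  Gens 7–9 proved both from kinematics: `LandauCorrectionSupB8Curved.landauCorrectionSupB8_cavg_of_regularSup` gives
`hF5`'s conclusion from `RegularSup d L N b′ c′ (j+2) U_B` + (Rb) + two level-free numeric lines, with explicit uniform `K₀ K₁`.  The END's own antecedent carries only the
`ℓ²` shape `Regular`; the SUP shape is exactly the leaf (H3ˢᵘᵖ) = `LeafIndexSockets.LeafH3sup` of route (A) (minimisers of the class are `RegularSup` at every level,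
[B11] Thm 1 (8)+(10) TYPE).  So:

* §1 **`hF5_of_leafH3sup`** — the binder `hF5` of THE END, for ANY `K₀ K₁` above the explicit uniform constants, ⇐ `LeafH3sup d L N ε b′ c′ dom` ∧ `0 ≤ b′, c′` ∧
  (Rb) `2^15(d+1)²(d+4)²L²b′ ≤ 1` ∧ `23040d⁴(frameC+d)²ε ≤ 1` ∧ `23040d⁴(frameC+d)³(c′ + curConst·b′²) ≤ 1`.
* §2 **`ne3EnergyRateWCov_sfClass_B8_of_leafH3sup`** — THE END re-run with `hF5` replaced by those hypotheses: SAME conclusion, SAME other binders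
  (`hB8` = `PairLandauGaugeB8Avg`, `hF6` = Π-REG majorant, `hP` = (P♮) on `slicB8`, the uniform numeric lines with `K₀ K₁` now merely bounded below).
* §3 **`ne3EnergyRateWCov_sfClass_small_of_leafH3sup`** — NE3's LOCAL HALF OVER BAŁABAN's CLASS WITH THE SUP LETTER GONE AND THE NUMERIC LINES DISCHARGED: there is `r > 0`
  such that for all `0 < ε ≤ r`, `0 ≤ s₁ ≤ r`, `0 ≤ b ≤ ε∕2`: `PairLandauGaugeB8Avg` ∧ (H3ˢᵘᵖ) with letters `(b′, c′)` on their two numeric lines ∧ per pair (P♮) on `slicB8`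
  ⟹ `∃ C, NE3EnergyRateWCov d (sfClass d L N ε) L N b g C s₁ s₂ dom` — gen 7's `ne3EnergyRateWCov_sfClass_small_of_supFacts` with BOTH sup facts proved
  (gen 5's `EndLinesNonVacuous.ne3EnergyRateWCov_sfClass_small` at `K* = 2·(d·liftC·36dF^k·c_R·(6 + 2(d+1)))`, `r` shrunk below `1∕(2cruxC+2)` and `1∕(23040d⁴F²)`);
  `leafLines_exists` — the two lines on `(b′, c′)` hold for some POSITIVE `(b′, c′)` (non-vacuity, G4-style).

CONTENT (0 sorry; no `def`; [folklore] bookkeeping over landed theorems BY NAME).  HONEST FRAMING.  One [B9]-§3-TYPE binder of THE END is traded for the [B11]-Thm-1-TYPE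
leaf (H3ˢᵘᵖ) that the programme's route (A) already lists (`LeafIndexSockets`) plus numeric lines; (H3ˢᵘᵖ) itself, `PairLandauGaugeB8Avg` ([B8] Thm 2 ∘ [B11] Thm 1 TYPE),
Π-REG, (P♮) at curved `W` ([B9] Thm 3.3 TYPE) REMAIN HYPOTHESES; nothing of Bałaban's asserted; the covariant root and **NE3 are NOT proved**; spine PROVED 0∕9; finite T⁴
rung (B)+1 — NOT infinite volume, NOT mass gap, NOT `BetaPertH`, NOT Clay.  PLACEMENT: `Summits/QuantumFields/BalabanUV/T4Continuum/Spine/NE3/`; imports accepted modules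
only; moves nothing.  HONEST DEPENDENCY (cell page 1): continuum YM on T⁴ ⇐ BetaPertH ∧ nine spine estimates (0/9 proved); BetaPertH ⇐ (D1) ∧ (D4) ∧ CAP+tail.
-/

set_option autoImplicit false

open scoped BigOperators Matrix.Norms.L2Operator
open NormedSpace Finset

namespace Summit.QuantumFields.BalabanUV.T4Continuum.NE3.PairLandauB8EndSfClassH3sup

open Set
open Literature.MathematicalPhysics.QuantumFieldTheory.Balaban1983to89
open B7Prop1Explicit B7Prop2Explicit B7Prop3Flat MatrixLog
open T4AveragingDeficitWall (IsSkewDir IsUnitaryCfg SmallField)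
open T4AveragingDeficitWallBoundary (IsPeriodicCfg periodBox)
open AveragingDeficitPeriodicCounting (IsPeriodicDir)
open AveragingDeficitChartCalculus (cavg)
open AveragingDeficitMultiLevelPrep (LevelSmall)
open AveragingDeficitTwoLevelPrep (twoLevelSmall)
open MinimalActionSandwich (IsMinimiser)
open MinimalActionRate (Regular sfClass)
open MinimalActionRefine (RegularSup)
open BlockAverageCurrent (curConst curConst_nonneg)
open NE3EnergyWeightedCovShape (NE3EnergyRateWCov)
open NE3SlicePoincareShape (SlicePoincare)
open NE3EnergyRateWSupOfSlicePoincare (cLambda)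
open NE3LinearNormalPartPreSizes (LocalSupMajorant)
open NE3QbarIterCovLiftPrep (cruxC liftC liftC_nonneg)
open NE3RightInverseSolveLetters (thetaLoc)
open NE3RightInverseSupLetters (frameC)
open NE3.PairLandauB8Avg (LandauRepB8Avg PairLandauGaugeB8Avg slicB8)
open NE3.LandauProjectionSupShape (LandauCorrectionSupB8)
open NE3.PairLandauB8EndSfClassB8 (ne3EnergyRateWCov_sfClass_B8)
open NE3.LandauCorrectionSupB8Curved (landauCorrectionSupB8_cavg_of_regularSup)
open NE3.LeafIndexSockets (LeafH3sup)
open NE3RightInverseSolveLetters (cruxC_nonneg)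
open NE3.EndLinesNonVacuous (ne3EnergyRateWCov_sfClass_small)
open NE3.PairLandauB8EndSupFacts (cruxC_eps_le_half supFacts_const_le)
open NE3.SupRegularityCurvedUniform (one_le_frameC_add)

noncomputable section

variable {d : ℕ} {n : Type*} [Fintype n] [DecidableEq n]

/-! ## §1 The binder `hF5` from the leaf (H3ˢᵘᵖ) -/

/-- **THE END's BINDER `hF5` FROM THE SUP-FORM THM-1-TYPE LEAF (H3ˢᵘᵖ)** (`d ≥ 1`, `L ≥ 2`, `N ≥ 1`): for every `K₀, K₁` above the explicit uniform constants of
`landauCorrectionSupB8_cavg_of_regularSup`, `LeafH3sup d L N ε b′ c′ dom` (+ `0 ≤ b′, c′`, (Rb), two numeric lines) gives, for every `j`, every `V ∈ dom` and every minimiser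
`U_B` of level `j+2`, `LandauCorrectionSupB8 hL j hWu hx hs hWx N hθ K₀ K₁` at `W = cavg L U_B` — verbatim the binder `hF5` of `ne3EnergyRateWCov_sfClass_B8` (its `Regular`
antecedent is not even used). [folklore] -/
theorem hF5_of_leafH3sup [Nonempty n] (hd : 1 ≤ d) {L N : ℕ} [NeZero N] (hL : 2 ≤ L) {ε b g b' c' K₀ K₁ : ℝ}
    {dom : _root_.Set (Site d → Fin d → (Matrix n n ℂ)ˣ)} (h3 : LeafH3sup d L N ε b' c' dom) (hb' : 0 ≤ b') (hc' : 0 ≤ c')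
    (hRb : 2 ^ 15 * ((d : ℝ) + 1) ^ 2 * ((d : ℝ) + 4) ^ 2 * (L : ℝ) ^ 2 * b' ≤ 1)
    (hεF : 23040 * (d : ℝ) ^ 4 * (frameC d L + d) ^ 2 * ε ≤ 1)
    (hcF : 23040 * (d : ℝ) ^ 4 * (frameC d L + d) ^ 3 * (c' + curConst d L * b' ^ 2) ≤ 1)
    (hK₀ge : (d : ℝ) * liftC d * (6 + 2 * ((d : ℝ) + 1) * ε) * (36 * d * (frameC d L + d) ^ 2)
        * (1 + 2 * (Fintype.card n : ℝ) * (64 * (d : ℝ) ^ 2 * N) ^ d + 27 * (Fintype.card n : ℝ) ^ 3 * (512 : ℝ) ^ d * (N : ℝ) ^ d) / (1 - cruxC d L * ε) ≤ K₀)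
    (hK₁ge : (d : ℝ) * liftC d * (6 + 2 * ((d : ℝ) + 1) * ε) * (36 * d * (frameC d L + d))
        * (1 + 2 * (Fintype.card n : ℝ) * (64 * (d : ℝ) ^ 2 * N) ^ d + 27 * (Fintype.card n : ℝ) ^ 3 * (512 : ℝ) ^ d * (N : ℝ) ^ d) / (1 - cruxC d L * ε) ≤ K₁) :
    ∀ j : ℕ, ∀ V ∈ dom, ∀ UB : Site d → Fin d → (Matrix n n ℂ)ˣ,
      IsMinimiser d (sfClass d L N ε) L N (j + 2) V UB → Regular d L N b g (j + 2) UB →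
      ∀ (hWu : IsUnitaryCfg (cavg L UB)) (hx : 0 ≤ ε / ((L : ℝ) ^ (j + 1)) ^ 2) (hs : LevelSmall d L j (ε / ((L : ℝ) ^ (j + 1)) ^ 2))
        (hWx : SmallField (cavg L UB) (ε / ((L : ℝ) ^ (j + 1)) ^ 2))
        (hθ : cruxC d L * (((L : ℝ) ^ (j + 1)) ^ 2 * (ε / ((L : ℝ) ^ (j + 1)) ^ 2)) < 1), LandauCorrectionSupB8 hL j hWu hx hs hWx N hθ K₀ K₁ := by
  intro j V hV UB hmin _ hWu hx hs hWx hθ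
  have hreg : RegularSup d L N b' c' (j + 2) UB := h3 V hV (j + 1) UB hmin
  exact (landauCorrectionSupB8_cavg_of_regularSup hd hL j hreg hb' hc' hRb hεF hcF hWu hx hs hWx hθ).mono hL j hWu hx hs hWx N hθ hK₀ge hK₁ge

/-! ## §2 THE END with `hF5` discharged by (H3ˢᵘᵖ) -/

/-- **THE END ON B8's SURFACE OVER `sfClass` WITH THE SUP LETTER DISCHARGED BY (H3ˢᵘᵖ)**: `ne3EnergyRateWCov_sfClass_B8` verbatim, its binder `hF5` replaced by
`LeafH3sup d L N ε b′ c′ dom` ∧ `0 ≤ b′, c′` ∧ (Rb) ∧ `23040d⁴(frameC+d)²ε ≤ 1` ∧ `23040d⁴(frameC+d)³(c′ + curConst·b′²) ≤ 1` ∧ `K₀, K₁` above the explicit uniform constants.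
[folklore] -/
theorem ne3EnergyRateWCov_sfClass_B8_of_leafH3sup [Nonempty n] (hd : 3 ≤ d) {L N : ℕ} [NeZero L] [NeZero N] (hL : 2 ≤ L) (hN : 1 ≤ N)
    {ε b g : ℝ} (hb : 0 ≤ b) (hbε : b < ε) (hε1 : ε ≤ 1) (hg : 0 < g)
    (hbs : 512 * (d + 1) * (d + 4) * (L : ℝ) ^ 2 * b ≤ 1) (hbε' : b + 226 * (8 * (d + 1) * (d + 4)) ^ 2 * b ^ 2 ≤ ε)
    (h1 : 16 * (14464 * ((d : ℝ) + 1) ^ 2 * ((d : ℝ) + 4) ^ 2) * ε ≤ 3) (h2 : 2 * twoLevelSmall d L * ε ≤ (L : ℝ) ^ 2)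
    (hθε : cruxC d L * ε < 1) (hθlε : thetaLoc d L * ε < 1)
    (hPsε : 8 * d * (((d : ℝ) - 1) * ε) ^ 2
      + 2 * (Fintype.card n * ((4 * (d : ℝ) ^ 2 + 16 * d * (17 * (((d : ℝ) + 1) * ((d : ℝ) + 4)))) * ε) ^ 2) ≤ 1 / 2)
    -- the [B7]-Prop-4 regime
    {α₀ s₁ s₂ : ℝ} (hα : 0 < α₀) (hα3 : C0 d * α₀ ≤ 1 / 3) (hα4 : 4 * α₀ ≤ c2' d L) (hεα : ε < α₀) (hs₁ : 0 ≤ s₁)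
    (hsmall : Real.exp (4 * (800 * ((d : ℝ) + 1) ^ 2 * ((d : ℝ) + 4)) * α₀) * (1 + 8 * (131072 * ((d : ℝ) + 1) ^ 2) * s₁) ≤ 2)
    (hc₃ : 2 * s₁ ≤ c3 d L)
    -- the uniform constants and letters, and the uniform size lines
    {Chat K₀ K₁ AN Ac ah Λ CP : ℝ} (hChat : 0 ≤ Chat) (hK₀ : 0 ≤ K₀) (hK₁ : 0 ≤ K₁) (hCP : 0 ≤ CP)
    (hAN : (liftC d / (1 - cruxC d L * ε) + K₁) * ((8 * (131072 * ((d : ℝ) + 1) ^ 2) * Real.exp (4 * (800 * ((d : ℝ) + 1) ^ 2 * ((d : ℝ) + 4)) * α₀)) * s₁ ^ 2) ≤ AN)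
    (hAc : (2 * (liftC d * (17 + 16 * (d : ℝ))) / (1 - cruxC d L * ε) + 2 * ε * K₀) * ((8 * (131072 * ((d : ℝ) + 1) ^ 2) * Real.exp (4 * (800 * ((d : ℝ) + 1) ^ 2 * ((d : ℝ) + 4)) * α₀)) * s₁ ^ 2) ≤ Ac)
    (hah : 3 * ε + 2 * Ac + 8192 * ((s₁ + AN) * AN) + 48 * s₁ ^ 2 + 1300 * ((s₁ + AN) + (1 + 2048 * (s₁ + AN)) * AN) ^ 2 ≤ ah)
    (hlines₁ : 50 * s₁ ≤ 1) (hlineJ : s₁ + 43 * AN ≤ 1) (hlineN : 1350 * AN ≤ 1) (hlineα : 20 * (s₁ + AN) ≤ 1)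
    (hlineαN : 50 * ((1 + 1024 * (s₁ + AN)) * AN) ≤ 1)
    (hρ : 2 * ((2 * (liftC d / (1 - thetaLoc d L * ε)) ^ 2 + 8 * Fintype.card n * ((d : ℝ) * liftC d ^ 2 * (2 * (d : ℝ) + 8) ^ 2 / (1 - thetaLoc d L * ε) ^ 2)) + (2 * (4 * d * (liftC d * (17 + 16 * (d : ℝ))) ^ 2 / (1 - thetaLoc d L * ε) ^ 2) + 128 * Fintype.card (T4AveragingDeficitWall.Plane d) * Fintype.card n * ((d : ℝ) * liftC d ^ 2 * (2 * (d : ℝ) + 8) ^ 2 / (1 - thetaLoc d L * ε) ^ 2))) * (8 * (131072 * ((d : ℝ) + 1) ^ 2) * Real.exp (4 * (800 * ((d : ℝ) + 1) ^ 2 * ((d : ℝ) + 4)) * α₀)) ^ 2 * Chat ^ 2 * s₁ ^ 2 ≤ 1 / 2)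
    (hlineΛ : (1 + 24 * Real.sqrt d * (Real.exp (10 * ((s₁ + AN) + (1 + 2048 * (s₁ + AN)) * AN)) - 1)) ^ 2 + 48 * d * ah ≤ Λ)
    (hlineCP : 112 * (d : ℝ) * ah * CP ≤ 1 / (2 * (Fintype.card n : ℝ)))
    (hreg₁ : CP * (Real.sqrt Λ - 1) ^ 2 ≤ 1 / 4)
    (hbudget : 2 * Λ * (2 * (1 + 4 * Real.sqrt (16 * d + 1)) * ((1 + 2048 * Real.sqrt (16 * d + 1)) * (2 * Real.sqrt ((2 * (liftC d / (1 - thetaLoc d L * ε)) ^ 2 + 8 * Fintype.card n * ((d : ℝ) * liftC d ^ 2 * (2 * (d : ℝ) + 8) ^ 2 / (1 - thetaLoc d L * ε) ^ 2)) + (2 * (4 * d * (liftC d * (17 + 16 * (d : ℝ))) ^ 2 / (1 - thetaLoc d L * ε) ^ 2) + 128 * Fintype.card (T4AveragingDeficitWall.Plane d) * Fintype.card n * ((d : ℝ) * liftC d ^ 2 * (2 * (d : ℝ) + 8) ^ 2 / (1 - thetaLoc d L * ε) ^ 2))) * (8 * (131072 * ((d : ℝ) + 1) ^ 2) * Real.exp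 (4 * (800 * ((d : ℝ) + 1) ^ 2 * ((d : ℝ) + 4)) * α₀)) * Chat * s₁))) + Λ * (2 * (1 + 4 * Real.sqrt (16 * d + 1)) * ((1 + 2048 * Real.sqrt (16 * d + 1)) * (2 * Real.sqrt ((2 * (liftC d / (1 - thetaLoc d L * ε)) ^ 2 + 8 * Fintype.card n * ((d : ℝ) * liftC d ^ 2 * (2 * (d : ℝ) + 8) ^ 2 / (1 - thetaLoc d L * ε) ^ 2)) + (2 * (4 * d * (liftC d * (17 + 16 * (d : ℝ))) ^ 2 / (1 - thetaLoc d L * ε) ^ 2) + 128 * Fintype.card (T4AveragingDeficitWall.Plane d) * Fintype.card n * ((d : ℝ) * liftC d ^ 2 * (2 * (d : ℝ) + 8) ^ 2 / (1 - thetaLoc d L * ε) ^ 2))) * (8 * (131072 * ((d : ℝ) + 1) ^ 2) * Real.exp (4 * (800 * ((d : ℝ) + 1) ^ 2 * ((d : ℝ) + 4)) * α₀)) * Chat * s₁))) ^ 2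
        + (2 * (4 * (2 * d * (liftC d * (17 + 16 * (d : ℝ))) / (1 - thetaLoc d L * ε) + 8 * Fintype.card (T4AveragingDeficitWall.Plane d) * Real.sqrt (Fintype.card n * ((d : ℝ) * liftC d ^ 2 * (2 * (d : ℝ) + 8) ^ 2 / (1 - thetaLoc d L * ε) ^ 2) * (N : ℝ) ^ d)) * (8 * (131072 * ((d : ℝ) + 1) ^ 2) * Real.exp (4 * (800 * ((d : ℝ) + 1) ^ 2 * ((d : ℝ) + 4)) * α₀)) * Chat ^ 2 * ah + 8192 * d * (4 * (liftC d / (1 - thetaLoc d L * ε) + 2 * Real.sqrt ((d : ℝ) * Fintype.card n * ((d : ℝ) * liftC d ^ 2 * (2 * (d : ℝ) + 8) ^ 2 / (1 - thetaLoc d L * ε) ^ 2) * (N : ℝ) ^ d)) * (8 * (131072 * ((d : ℝ) + 1) ^ 2) * Real.exp (4 * (800 * ((d : ℝ) + 1) ^ 2 * ((d : ℝ) + 4)) * α₀)) * Chat ^ 2 * ah)) + 912 * d * (1806 * (4 * (liftC d / (1 - thetaLoc d L * ε) + 2 * Real.sqrt ((d : ℝ) * Fintype.card n * ((d : ℝ)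 * liftC d ^ 2 * (2 * (d : ℝ) + 8) ^ 2 / (1 - thetaLoc d L * ε) ^ 2) * (N : ℝ) ^ d)) * (8 * (131072 * ((d : ℝ) + 1) ^ 2) * Real.exp (4 * (800 * ((d : ℝ) + 1) ^ 2 * ((d : ℝ) + 4)) * α₀)) * Chat ^ 2 * ah))) ≤ cLambda n CP Λ / 2)
    -- [B8] Thm 2 + (1.37) at the pair, over the class
    {dom : _root_.Set (Site d → Fin d → (Matrix n n ℂ)ˣ)} (hB8 : PairLandauGaugeB8Avg d (sfClass d L N ε) L N b g s₁ s₂ 1 dom)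
    -- per pair: the Π-REG majorant (uniform constant `Ĉ`)
    (hF6 : ∀ j : ℕ, ∀ V ∈ dom, ∀ UA UB : Site d → Fin d → (Matrix n n ℂ)ˣ,
      IsMinimiser d (sfClass d L N ε) L N (j + 1) V UA → IsMinimiser d (sfClass d L N ε) L N (j + 2) V UB → Regular d L N b g (j + 2) UB →
      ∀ (u : Site d → (Matrix n n ℂ)ˣ) (Z : Site d → Fin d → Matrix n n ℂ), LandauRepB8Avg L N (j + 1) (cavg L UB) UA u Z s₁ s₂ 1 →
        ∃ m : Site d → Fin d → ℝ, LocalSupMajorant L N (j + 1) Z m Chat ∧ ∀ (z : Site d) (κ : Fin d), m z κ ≤ s₁ * ((L : ℝ)⁻¹) ^ (j + 1))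
    -- per pair: INSTEAD of the F5 shape — the sup-form Thm-1-TYPE leaf (H3ˢᵘᵖ) with its letters `b' c'`, three level-free numeric lines, and `K₀ K₁` above the
    -- explicit uniform constants of `LandauCorrectionSupB8Curved.landauCorrectionSupB8_cavg_of_regularSup`
    {b' c' : ℝ} (h3 : LeafH3sup d L N ε b' c' dom) (hb' : 0 ≤ b') (hc' : 0 ≤ c')
    (hRb : 2 ^ 15 * ((d : ℝ) + 1) ^ 2 * ((d : ℝ) + 4) ^ 2 * (L : ℝ) ^ 2 * b' ≤ 1)
    (hεF : 23040 * (d : ℝ) ^ 4 * (frameC d L + d) ^ 2 * ε ≤ 1)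
    (hcF : 23040 * (d : ℝ) ^ 4 * (frameC d L + d) ^ 3 * (c' + curConst d L * b' ^ 2) ≤ 1)
    (hK₀ge : (d : ℝ) * liftC d * (6 + 2 * ((d : ℝ) + 1) * ε) * (36 * d * (frameC d L + d) ^ 2)
        * (1 + 2 * (Fintype.card n : ℝ) * (64 * (d : ℝ) ^ 2 * N) ^ d + 27 * (Fintype.card n : ℝ) ^ 3 * (512 : ℝ) ^ d * (N : ℝ) ^ d) / (1 - cruxC d L * ε) ≤ K₀)
    (hK₁ge : (d : ℝ) * liftC d * (6 + 2 * ((d : ℝ) + 1) * ε) * (36 * d * (frameC d L + d))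
        * (1 + 2 * (Fintype.card n : ℝ) * (64 * (d : ℝ) ^ 2 * N) ^ d + 27 * (Fintype.card n : ℝ) ^ 3 * (512 : ℝ) ^ d * (N : ℝ) ^ d) / (1 - cruxC d L * ε) ≤ K₁)
    -- per pair: (P♮) on B8's slice (uniform constant `CP`)
    (hP : ∀ j : ℕ, ∀ V ∈ dom, ∀ UB : Site d → Fin d → (Matrix n n ℂ)ˣ,
      IsMinimiser d (sfClass d L N ε) L N (j + 2) V UB → Regular d L N b g (j + 2) UB →
      SlicePoincare L (j + 1) (cavg L UB) (slicB8 L N (j + 1) (cavg L UB)) CP (periodBox (N * L ^ (j + 1)))) :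
    NE3EnergyRateWCov d (sfClass d L N ε) L N b g
      ((1 + (((1 + 2048 * Real.sqrt (16 * d + 1)) * (2 * Real.sqrt ((2 * (liftC d / (1 - thetaLoc d L * ε)) ^ 2 + 8 * Fintype.card n * ((d : ℝ) * liftC d ^ 2 * (2 * (d : ℝ) + 8) ^ 2 / (1 - thetaLoc d L * ε) ^ 2)) + (2 * (4 * d * (liftC d * (17 + 16 * (d : ℝ))) ^ 2 / (1 - thetaLoc d L * ε) ^ 2) + 128 * Fintype.card (T4AveragingDeficitWall.Plane d) * Fintype.card n * ((d : ℝ) * liftC d ^ 2 * (2 * (d : ℝ) + 8) ^ 2 / (1 - thetaLoc d L * ε) ^ 2))) * (8 * (131072 * ((d : ℝ) + 1) ^ 2) * Real.exp (4 * (800 * ((d : ℝ) + 1) ^ 2 * ((d : ℝ) + 4)) * α₀)) * Chat * s₁)) + 23 * Real.sqrt 2 * Real.sqrt (16 * d + 1) * (1 + ((1 + 2048 * Real.sqrt (16 * d + 1)) * (2 * Real.sqrt ((2 * (liftC d / (1 - thetaLoc d L * ε)) ^ 2 + 8 * Fintype.card n * ((d : ℝ) * liftC d ^ 2 * (2 *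 (d : ℝ) + 8) ^ 2 / (1 - thetaLoc d L * ε) ^ 2)) + (2 * (4 * d * (liftC d * (17 + 16 * (d : ℝ))) ^ 2 / (1 - thetaLoc d L * ε) ^ 2) + 128 * Fintype.card (T4AveragingDeficitWall.Plane d) * Fintype.card n * ((d : ℝ) * liftC d ^ 2 * (2 * (d : ℝ) + 8) ^ 2 / (1 - thetaLoc d L * ε) ^ 2))) * (8 * (131072 * ((d : ℝ) + 1) ^ 2) * Real.exp (4 * (800 * ((d : ℝ) + 1) ^ 2 * ((d : ℝ) + 4)) * α₀)) * Chat * s₁))))) * (4 / cLambda n CP Λ)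
        * ((1 + Real.sqrt (192 * ((d : ℝ) * L) * (d + Fintype.card (T4AveragingDeficitWall.Plane d))))
          * (Real.sqrt ((L : ℝ) ^ (d - 2))
            + (Real.sqrt ((L : ℝ) ^ (d - 2)) * Real.sqrt (8 * Fintype.card (T4AveragingDeficitWall.Plane d))
                * (128 * (d * (L : ℝ) ^ 2))
              + 2 * (2048 * ((d : ℝ) + 4) ^ 2 * (L : ℝ) ^ 2 * Real.sqrt (d * (L : ℝ) ^ d))) * b
            + b ^ 2 * (2 * (L : ℝ) ^ (d - 1) + 2 * (8 * d * (L : ℝ) ^ d)) * Real.sqrt (d / (g * (L : ℝ) ^ (d + 2))))))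
      s₁ s₂ dom :=
  ne3EnergyRateWCov_sfClass_B8 hd hL hN hb hbε hε1 hg hbs hbε' h1 h2 hθε hθlε hPsε hα hα3 hα4 hεα hs₁ hsmall hc₃ hChat hK₀ hK₁ hCP hAN hAc hah hlines₁ hlineJ
    hlineN hlineα hlineαN hρ hlineΛ hlineCP hreg₁ hbudget hB8 hF6
    (hF5_of_leafH3sup (le_trans (by norm_num) hd) hL h3 hb' hc' hRb hεF hcF hK₀ge hK₁ge) hP

/-! ## §3 NE3's local half over Bałaban's class: the sup letter gone, the numeric lines discharged -/

/-- **NE3's LOCAL HALF OVER BAŁABAN's CLASS WITH THE SUP LETTER GONE** (`3 ≤ d`, `2 ≤ L`, `1 ≤ N`, `g > 0`, `CP ≥ 0`; leaf letters `0 ≤ b′, c′` on the two numeric lines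
(Rb) `2^15(d+1)²(d+4)²L²b′ ≤ 1`, `23040d⁴(frameC+d)³(c′ + curConst·b′²) ≤ 1`): there is `r > 0` such that for all `0 < ε ≤ r`, `0 ≤ s₁ ≤ r`, `0 ≤ b ≤ ε∕2`:
`PairLandauGaugeB8Avg d (sfClass d L N ε) L N b g s₁ s₂ 1 dom` ([B8] Thm 2 + (1.37) ∘ [B11] Thm 1 TYPE) ∧ `LeafH3sup d L N ε b′ c′ dom` ([B11] Thm 1 (8)+(10) TYPE) ∧ per pair (P♮) on
`slicB8` with constant `CP` ([B9] Thm 3.3 TYPE) ⟹ `∃ C, NE3EnergyRateWCov d (sfClass d L N ε) L N b g C s₁ s₂ dom` — the covariant root NE7 consumes.  Compared with gen 7's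
`ne3EnergyRateWCov_sfClass_small_of_supFacts`, the per-pair binders (H0_W) and (HR_W) are GONE (proved, gens 8–9). [folklore] -/
theorem ne3EnergyRateWCov_sfClass_small_of_leafH3sup [Nonempty n] (hd : 3 ≤ d) {L N : ℕ} [NeZero L] [NeZero N] (hL : 2 ≤ L) (hN : 1 ≤ N)
    {g CP b' c' : ℝ} (hg : 0 < g) (hCP : 0 ≤ CP) (hb' : 0 ≤ b') (hc' : 0 ≤ c')
    (hRb : 2 ^ 15 * ((d : ℝ) + 1) ^ 2 * ((d : ℝ) + 4) ^ 2 * (L : ℝ) ^ 2 * b' ≤ 1)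
    (hcF : 23040 * (d : ℝ) ^ 4 * (frameC d L + d) ^ 3 * (c' + curConst d L * b' ^ 2) ≤ 1) :
    ∃ r : ℝ, 0 < r ∧ ∀ ⦃ε s₁ b : ℝ⦄, 0 < ε → ε ≤ r → 0 ≤ s₁ → s₁ ≤ r → 0 ≤ b → b ≤ ε / 2 →
      ∀ (s₂ : ℝ) {dom : _root_.Set (Site d → Fin d → (Matrix n n ℂ)ˣ)},
        PairLandauGaugeB8Avg d (sfClass d L N ε) L N b g s₁ s₂ 1 dom →
        LeafH3sup d L N ε b' c' dom →
        (∀ j : ℕ, ∀ V ∈ dom, ∀ UB : Site d → Fin d → (Matrix n n ℂ)ˣ, IsMinimiser d (sfClass d L N ε) L N (j + 2) V UB → Regular d L N b g (j + 2) UB →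
          SlicePoincare L (j + 1) (cavg L UB) (slicB8 L N (j + 1) (cavg L UB)) CP (periodBox (N * L ^ (j + 1)))) →
        ∃ C : ℝ, NE3EnergyRateWCov d (sfClass d L N ε) L N b g C s₁ s₂ dom := by
  have hd1 : 1 ≤ d := le_trans (by norm_num) hd
  -- the level-free constant and the uniform majorants `K₀*`, `K₁*` of `K₀(ε)`, `K₁(ε)`
  obtain ⟨cR, hcR⟩ : ∃ K : ℝ, K = 1 + 2 * (Fintype.card n : ℝ) * (64 * (d : ℝ) ^ 2 * N) ^ d + 27 * (Fintype.card n : ℝ) ^ 3 * (512 : ℝ) ^ d * (N : ℝ) ^ d := ⟨_, rfl⟩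
  have hcR0 : 0 ≤ cR := by rw [hcR]; positivity
  have hF0 : 0 ≤ frameC d L + d := le_trans zero_le_one (one_le_frameC_add hd1 L)
  obtain ⟨K₀s, hK₀s⟩ : ∃ K : ℝ, K = 2 * ((d : ℝ) * liftC d * (36 * d * (frameC d L + d) ^ 2) * cR * (6 + 2 * ((d : ℝ) + 1))) := ⟨_, rfl⟩
  obtain ⟨K₁s, hK₁s⟩ : ∃ K : ℝ, K = 2 * ((d : ℝ) * liftC d * (36 * d * (frameC d L + d)) * cR * (6 + 2 * ((d : ℝ) + 1))) := ⟨_, rfl⟩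
  have hK₀ : 0 ≤ K₀s := by rw [hK₀s]; have := liftC_nonneg d; positivity
  have hK₁ : 0 ≤ K₁s := by rw [hK₁s]; have := liftC_nonneg d; positivity
  obtain ⟨r, hr0, hr⟩ := ne3EnergyRateWCov_sfClass_small (n := n) hd hL hN (CP := CP) hg hCP hK₀ hK₁
  have hc := cruxC_nonneg d L
  have hρ0 : 0 < 1 / (2 * cruxC d L + 2) := by positivity
  have hd0 : (0 : ℝ) < d := by exact_mod_cast hd1
  have hF1 : (1 : ℝ) ≤ frameC d L + d := one_le_frameC_add hd1 L
  have hF2 : 0 < 23040 * (d : ℝ) ^ 4 * (frameC d L + d) ^ 2 := by positivity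
  have hσ0 : 0 < 1 / (23040 * (d : ℝ) ^ 4 * (frameC d L + d) ^ 2) := by positivity
  refine ⟨min r (min (1 / (2 * cruxC d L + 2)) (1 / (23040 * (d : ℝ) ^ 4 * (frameC d L + d) ^ 2))), lt_min hr0 (lt_min hρ0 hσ0),
    fun ε s₁ b hε hεr hs₁ hs₁r hb hbh s₂ dom hB8 h3 hP => ?_⟩
  have hεr' : ε ≤ r := hεr.trans (min_le_left _ _)
  have hs₁r' : s₁ ≤ r := hs₁r.trans (min_le_left _ _)
  obtain ⟨hcε, hε1⟩ := cruxC_eps_le_half d L hε.le (hεr.trans ((min_le_right _ _).trans (min_le_left _ _)))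
  have hεF : 23040 * (d : ℝ) ^ 4 * (frameC d L + d) ^ 2 * ε ≤ 1 := by
    have h1 : ε ≤ 1 / (23040 * (d : ℝ) ^ 4 * (frameC d L + d) ^ 2) := hεr.trans ((min_le_right _ _).trans (min_le_right _ _))
    rw [le_div_iff₀ hF2] at h1; linarith
  -- `K(ε) ≤ K*`
  have hle₀ : (d : ℝ) * liftC d * (6 + 2 * ((d : ℝ) + 1) * ε) * (36 * d * (frameC d L + d) ^ 2)
        * (1 + 2 * (Fintype.card n : ℝ) * (64 * (d : ℝ) ^ 2 * N) ^ d + 27 * (Fintype.card n : ℝ) ^ 3 * (512 : ℝ) ^ d * (N : ℝ) ^ d) / (1 - cruxC d L * ε) ≤ K₀s := by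
    rw [← hcR, hK₀s]
    have hA : 0 ≤ (d : ℝ) * liftC d * (36 * d * (frameC d L + d) ^ 2) * cR := by have := liftC_nonneg d; positivity
    have key := supFacts_const_le d L hA hε.le hε1 hcε
    calc (d : ℝ) * liftC d * (6 + 2 * ((d : ℝ) + 1) * ε) * (36 * d * (frameC d L + d) ^ 2) * cR / (1 - cruxC d L * ε)
        = (d : ℝ) * liftC d * (36 * d * (frameC d L + d) ^ 2) * cR * (6 + 2 * ((d : ℝ) + 1) * ε) / (1 - cruxC d L * ε) := by ring
      _ ≤ 2 * ((d : ℝ) * liftC d * (36 * d * (frameC d L + d) ^ 2) * cR * (6 + 2 * ((d : ℝ) + 1))) := key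
  have hle₁ : (d : ℝ) * liftC d * (6 + 2 * ((d : ℝ) + 1) * ε) * (36 * d * (frameC d L + d))
        * (1 + 2 * (Fintype.card n : ℝ) * (64 * (d : ℝ) ^ 2 * N) ^ d + 27 * (Fintype.card n : ℝ) ^ 3 * (512 : ℝ) ^ d * (N : ℝ) ^ d) / (1 - cruxC d L * ε) ≤ K₁s := by
    rw [← hcR, hK₁s]
    have hA : 0 ≤ (d : ℝ) * liftC d * (36 * d * (frameC d L + d)) * cR := by have := liftC_nonneg d; positivity
    have key := supFacts_const_le d L hA hε.le hε1 hcε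
    calc (d : ℝ) * liftC d * (6 + 2 * ((d : ℝ) + 1) * ε) * (36 * d * (frameC d L + d)) * cR / (1 - cruxC d L * ε)
        = (d : ℝ) * liftC d * (36 * d * (frameC d L + d)) * cR * (6 + 2 * ((d : ℝ) + 1) * ε) / (1 - cruxC d L * ε) := by ring
      _ ≤ 2 * ((d : ℝ) * liftC d * (36 * d * (frameC d L + d)) * cR * (6 + 2 * ((d : ℝ) + 1))) := key
  exact hr hε hεr' hs₁ hs₁r' hb hbh s₂ hB8 (hF5_of_leafH3sup hd1 hL h3 hb' hc' hRb hεF hcF hle₀ hle₁) hP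

/-- **THE TWO NUMERIC LINES ON THE LEAF LETTERS ARE SATISFIED BY POSITIVE `(b′, c′)`** (non-vacuity of §3's side conditions, G4-style; `d ≥ 1`):
e.g. `b′ = (2^15(d+1)²(d+4)²L² + 1)⁻¹·(…)`-small and `c′` small. [folklore] -/
theorem leafLines_exists (hd : 1 ≤ d) (L : ℕ) : ∃ b' c' : ℝ, 0 < b' ∧ 0 < c' ∧
    2 ^ 15 * ((d : ℝ) + 1) ^ 2 * ((d : ℝ) + 4) ^ 2 * (L : ℝ) ^ 2 * b' ≤ 1 ∧
    23040 * (d : ℝ) ^ 4 * (frameC d L + d) ^ 3 * (c' + curConst d L * b' ^ 2) ≤ 1 := by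
  have hF1 : (1 : ℝ) ≤ frameC d L + d := one_le_frameC_add hd L
  have hcur := curConst_nonneg (d := d) L
  set A : ℝ := 2 ^ 15 * ((d : ℝ) + 1) ^ 2 * ((d : ℝ) + 4) ^ 2 * (L : ℝ) ^ 2 + 1 with hA
  set B : ℝ := 23040 * (d : ℝ) ^ 4 * (frameC d L + d) ^ 3 * (1 + curConst d L) + 1 with hB
  have hA1 : 1 ≤ A := by
    have h0 : (0 : ℝ) ≤ 2 ^ 15 * ((d : ℝ) + 1) ^ 2 * ((d : ℝ) + 4) ^ 2 * (L : ℝ) ^ 2 := by positivity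
    rw [hA]; linarith
  have hF0 : (0 : ℝ) ≤ frameC d L + d := le_trans zero_le_one hF1
  have hB1 : 1 ≤ B := by
    have h0 : (0 : ℝ) ≤ 23040 * (d : ℝ) ^ 4 * (frameC d L + d) ^ 3 * (1 + curConst d L) := by positivity
    rw [hB]; linarith
  have hA0 : 0 < A := by linarith
  have hB0 : 0 < B := by linarith
  refine ⟨(A * B)⁻¹, B⁻¹, by positivity, by positivity, ?_, ?_⟩
  · -- `2^15(…)L²·(AB)⁻¹ ≤ A·(AB)⁻¹ = B⁻¹ ≤ 1`
    have h1 : 2 ^ 15 * ((d : ℝ) + 1) ^ 2 * ((d : ℝ) + 4) ^ 2 * (L : ℝ) ^ 2 ≤ A := by rw [hA]; linarith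
    calc 2 ^ 15 * ((d : ℝ) + 1) ^ 2 * ((d : ℝ) + 4) ^ 2 * (L : ℝ) ^ 2 * (A * B)⁻¹ ≤ A * (A * B)⁻¹ :=
          mul_le_mul_of_nonneg_right h1 (by positivity)
      _ = B⁻¹ := by field_simp
      _ ≤ 1 := inv_le_one_of_one_le₀ hB1
  · -- `(AB)⁻² ≤ B⁻¹` and `c′ + curConst·b′² ≤ (1 + curConst)·B⁻¹`
    have hAB1 : 1 ≤ A * B := one_le_mul_of_one_le_of_one_le hA1 hB1
    have h2 : ((A * B)⁻¹) ^ 2 ≤ B⁻¹ := by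
      have h3 : ((A * B)⁻¹) ^ 2 ≤ (A * B)⁻¹ := by
        have h4 : (A * B)⁻¹ ≤ 1 := inv_le_one_of_one_le₀ hAB1
        have h5 : 0 ≤ (A * B)⁻¹ := by positivity
        nlinarith
      have h6 : (A * B)⁻¹ ≤ B⁻¹ := by
        rw [mul_inv]; exact mul_le_of_le_one_left (by positivity) (inv_le_one_of_one_le₀ hA1)
      exact h3.trans h6
    have h7 : B⁻¹ + curConst d L * ((A * B)⁻¹) ^ 2 ≤ (1 + curConst d L) * B⁻¹ := by
      have := mul_le_mul_of_nonneg_left h2 hcur; linarith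
    have h8 : 23040 * (d : ℝ) ^ 4 * (frameC d L + d) ^ 3 * (1 + curConst d L) ≤ B := by rw [hB]; linarith
    calc 23040 * (d : ℝ) ^ 4 * (frameC d L + d) ^ 3 * (B⁻¹ + curConst d L * ((A * B)⁻¹) ^ 2)
        ≤ 23040 * (d : ℝ) ^ 4 * (frameC d L + d) ^ 3 * ((1 + curConst d L) * B⁻¹) := mul_le_mul_of_nonneg_left h7 (by positivity)
      _ = 23040 * (d : ℝ) ^ 4 * (frameC d L + d) ^ 3 * (1 + curConst d L) * B⁻¹ := by ring
      _ ≤ B * B⁻¹ := mul_le_mul_of_nonneg_right h8 (by positivity)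
      _ = 1 := by field_simp

end

end Summit.QuantumFields.BalabanUV.T4Continuum.NE3.PairLandauB8EndSfClassH3sup
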